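/- Copyright: the b2b-balaban cell (near-miss cell 7), T⁴-continuum fan-out, row-NE7b OWNER lineage `t4-ne7b-p1` (gen 101) —
(α)-instance, THE END AT THE TOWER AT PRINT's ROUNDED RENEWAL LETTER, part 3R: the rounded record's `hw` slot from J4, ON THE NOSE.
Released under the licence of the surrounding project. -/
import Summits.QuantumFields.BalabanUV.T4Continuum.Support.B16HistoryTowerEndDataLWR
import Summits.QuantumFields.BalabanUV.T4Continuum.Support.B16HistoryTowerEndPrinted

/-!
# (α)-INSTANCE — THE END AT THE TOWER AT PRINT's ROUNDED RENEWAL LETTER, part 3R: the `hw` SLOT OF `TowerReadDataLWR` FROM [B16]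
pp. 380–383's PER-STEP SENTENCES (`StepDisplaysAt`) VIA J4, AT THE ROUNDED LETTER — NO WEAKENING, NO STRENGTHENING

Summits-side support leaf of the T⁴-continuum cell (rung (B)+1 on a FINITE torus only; NOT infinite volume, NOT the mass gap, NOT
Clay; NOT a proof of NE7b — the cell's OWN estimate `T4WeightBudget.RelWeightBound`, NOT PRINTED, NOT PROVED).  [folklore] one
letter-table identity and three instances of J4 (`B16HistoryStepJunction`, IR-100-3) at the rounded record's letters; no `Prop` minted,
nothing cited as hypothesis, zero `sorry`.

WHY (RULING R-ne7bp1-g101-5; the located reason is part 1R's docstring).  J4 proves `HwPinned T 𝒮 (sBsharp Dr c) (sRsharp Dr c) cΛ M gs K₀`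
at print's letters, the renewal one being the ROUNDED `B16HistoryStepJunction.sRsharp Dr c K h = (R(g_h)^{d+5})⁻¹·P1(g_h)²` ([B16] p. 383
after (1.78), right member).  The rounded tower record `TowerReadDataLWR` (part 1R) pins its renewal letter at `sRrnd D O p₁ g₀ 𝒮.R K h =
HistoryBankingSharpShares.sRsharp (O.d + 5) 1 p₁ (𝒮.R K) g^K h = (R_h^{d+5})⁻¹·(ℓ_h^{p₁})²` — THE SAME NUMBER under the letter tables
`c.d = O.d`, `R(g_h) = R_h` (print's (2.5): the sizes ARE `R(g_j)`), `P1(g_h) = ℓ_h^{p₁}` (`hsR_of_tables`, an EQUALITY).  So J4's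
output fills the record's `hw` slot ON THE NOSE (`HwPinned.of_le` at `le_of_eq`): NO `hsRdom`, NO sharp preparatory sentence — the
withdrawn road of part 3 v1 (π-gapsne6-g4-1: `sRpin ≤ sRsharp` unsatisfiable) and the over-sharp display of part 3 v1.2 §6
(π-gapsne6-g4-2: `lfPrep ≤ exp(−S_h)` fails for p. 382 CASE-1 factors) are BOTH retired by moving the END's letter, not print's.
NET: a consumer holding (A1c)'s tower data + `hdisp` + `hclass` + `hchain` (or `hvol`) + the three tables fills `TowerReadDataLWR`'s
`sB ∕ hw ∕ hsB` with `sBsharp (runsOf D g₀) c ∕ hw_of_stepDisplays_rounded … ∕ B16HistoryTowerEndPrinted.hsB_of_tables …` and gets the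
headline from part 2R's `continuumYM4Torus_of_towerReadingLWR_fsc`.  HONEST LIMITS: nothing of Bałaban's is asserted; the inputs are
displayed; NE7b NOT proved; count 0∕9.  HONEST DEPENDENCY (cell): continuum YM on T⁴ ⇐ BetaPertH ∧ nine spine estimates (0/9 proved);
BetaPertH ⇐ (D1) ∧ (D4) ∧ CAP+tail; G-an2-4 gates asym, D1 and NE2/3/4.  This file changes none of it.
-/

open Finset MeasureTheory
open Literature.MathematicalPhysics.QuantumFieldTheory.Balaban1983to89
open Literature.MathematicalPhysics.QuantumFieldTheory.Balaban1983to89.B16StepFactorsPrinted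
open Literature.MathematicalPhysics.QuantumFieldTheory.Balaban1983to89.B16LargeFieldFactors380 (minConst)
open T4PrintedShapeBanking T4Continuum
open Literature.MathematicalPhysics.QuantumFieldTheory.Balaban1983to89.TreeLength
open Literature.MathematicalPhysics.QuantumFieldTheory.Balaban1983to89.B16MergeGeometry
open Summit.QuantumFields.BalabanUV.T4Continuum.HistoryConstants
open Summit.QuantumFields.BalabanUV.T4Continuum.HistoryAdmissible
open Summit.QuantumFields.BalabanUV.T4Continuum.HistoryGenealogyExtraction
open Summit.QuantumFields.BalabanUV.T4Continuum.HistoryGenealogyRealise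
open Summit.QuantumFields.BalabanUV.T4Continuum.HistoryGenealogyInstantiate
open Summit.QuantumFields.BalabanUV.T4Continuum.B16HistoryIndexedRepr
open Summit.QuantumFields.BalabanUV.T4Continuum.B16HistoryReprChain
open Summit.QuantumFields.BalabanUV.T4Continuum.B16HistoryReprInstance
open Summit.QuantumFields.BalabanUV.T4Continuum.B16HistoryReprReadCausal
open Summit.QuantumFields.BalabanUV.T4Continuum.B16HistoryStepDisplayPinned
open Summit.QuantumFields.BalabanUV.T4Continuum.B16HistoryStepJunction
open Summit.QuantumFields.BalabanUV.T4Continuum.B16HistoryTowerEndDataLWL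
open Summit.QuantumFields.BalabanUV.T4Continuum.B16HistoryTowerEndDataLWR
open Summit.QuantumFields.BalabanUV.T4Continuum.B16HistoryTowerEndPrinted
open Summit.QuantumFields.BalabanUV.T4Continuum.HistoryBankingSharpShares (ell)
open Summit.QuantumFields.BalabanUV.T4Continuum.HistoryBankingVolumeWindowLattice (uvolL)

namespace Summit.QuantumFields.BalabanUV.T4Continuum.B16HistoryTowerEndPrintedR

noncomputable section

/-! ## §1 The letter table: the rounded record's renewal letter IS J4's sharp renewal letter -/

section Tables

variable {F : T4Family} {G : Type*} [GaugeGroup G] [MeasurableSpace G] [HaarData G]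

/-- **THE RENEWAL LETTER TABLE, AN EQUALITY**: if print's constants record `c` carries the cell's dimension (`c.d = O.d`), print's size
profile AT the run's couplings IS the reading's sizes (`R(g^K_h) = R_h` — (2.5)'s definition of `R_j`) and print's `p₁`-profile is
`ℓ^{p₁}` (`P1(g^K_h) = (log (g^K_h)⁻²)^{p₁}`), then `sRrnd D O p₁ g₀ R K h = B16HistoryStepJunction.sRsharp (runsOf D g₀) c K h`. [folklore] -/
theorem sRrnd_eq_sRsharp (D : FiniteEpsData F G) (O : PrintedO1s) (p₁ : ℕ) (g₀ : ℕ → ℝ) (R : ℕ → ℕ → ℕ)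
    (c : B16StepFactorsPrinted.Consts) (hd : c.d = O.d) (hR : ∀ K h, c.R (gsOf D g₀ K h) = (R K h : ℝ))
    (hP : ∀ K h, c.P1 (gsOf D g₀ K h) = ell (gsOf D g₀ K) h ^ p₁) (K h : ℕ) :
    sRrnd D O p₁ g₀ R K h = B16HistoryStepJunction.sRsharp (runsOf D g₀) c K h := by
  unfold sRrnd HistoryBankingSharpShares.sRsharp B16HistoryStepJunction.sRsharp
  rw [flow_runsOf, hd, hR, hP, one_mul]

end Tables

/-! ## §2 The rounded record's `hw` slot from J4, on the nose -/

section Junction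

variable {F : T4Family} {G : Type*} [GaugeGroup G] [MeasurableSpace G] [HaarData G]
  (D : FiniteEpsData F G) (O : PrintedO1s) (p₁ : ℕ) (g₀ : ℕ → ℝ)
  {P : Type} {d : ℕ} {X : ℕ → ℕ → Type} {𝒢 : (K j : ℕ) → GoodClass (X K j)}
  (T : (K : ℕ) → Tower P (X K) (𝒢 K)) (𝒮 : StepReading P d) (c : B16StepFactorsPrinted.Consts)
  (Xs : (K j : ℕ) → (Fin j → P) → StepData d P) (cΛ M : ℝ)

/-- **PART 1R's `hw` SLOT FROM J4, CORE FORM** (volume side displayed as J4's `hvol`): print's per-step sentences at the process carriers of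
the prefix's runs (`hdisp`, ALL FIVE conjuncts as J4 reads them — in particular the ROUNDED (P)), the `=` class junction (`hclass`), the
volume domination (`hvol`) and the renewal letter table (`hd`, `hR`, `hP`) give
`HwPinned T 𝒮 (sBsharp (runsOf D g₀) c) (sRrnd D O p₁ g₀ 𝒮.R) cΛ M (gsOf D g₀) K₀` — THE TYPE OF `TowerReadDataLWR.hw` at `sB := sBsharp
(runsOf D g₀) c`.  `= (hwPinned_of_stepDisplaysAt …).of_le le_rfl (le_of_eq table) le_rfl` — no letter moves. [folklore] -/
theorem hw_of_stepDisplays_rounded_of_hvol {K₀ : ℕ} (hc : 0 ≤ cΛ) (hM : 0 ≤ M)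
    (hℓ : ∀ K j, j ≤ K → 0 ≤ ell (gsOf D g₀ K) j)
    (hdisp : ∀ K, K₀ ≤ K → ∀ (j : ℕ) (g : Fin j → P),
      StepDisplaysAt (runsOf D g₀ K) j (carriersOf T 𝒮 (runsOf D g₀ K) K j g (Xs K j g)) c)
    (hclass : ∀ K, K₀ ≤ K → ∀ (j : ℕ) (g : Fin j → P) (p : P),
      ∀ x ∈ (𝒮.runPartial K (j + 1) (Fin.snoc g p)).histM.newPairs (j + 1),
        (Xs K j g).dC p x = (𝒮.κ K ((𝒮.runPartial K (j + 1) (Fin.snoc g p)).histM.newAt (j + 1) x) : ℝ))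
    (hvol : ∀ K, K₀ ≤ K → ∀ (j : ℕ) (g : Fin j → P) (p : P),
      (Xs K j g).gInt p * (Xs K j g).aInt p * (Xs K j g).vfac p ≤
        ∏ cc ∈ (𝒮.runPartial K (j + 1) (Fin.snoc g p)).histM.comp (j + 1),
          ΛexpL cΛ M d (gsOf D g₀) 𝒮.R K (j + 1) ^ (cc.2).card)
    (hd : c.d = O.d) (hR : ∀ K h, c.R (gsOf D g₀ K h) = (𝒮.R K h : ℝ))
    (hP : ∀ K h, c.P1 (gsOf D g₀ K h) = ell (gsOf D g₀ K) h ^ p₁) :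
    HwPinned T 𝒮 (sBsharp (runsOf D g₀) c) (sRrnd D O p₁ g₀ 𝒮.R) cΛ M (gsOf D g₀) K₀ :=
  (hwPinned_of_stepDisplaysAt T 𝒮 (runsOf D g₀) c Xs cΛ M (gsOf D g₀) hc hM hℓ hdisp hclass hvol).of_le
    (fun _ _ _ => le_rfl) (fun K h => (sRrnd_eq_sRsharp D O p₁ g₀ 𝒮.R c hd hR hP K h).le) le_rfl hM hℓ hc

/-- **PART 1R's `hw` SLOT FROM J4 + J4.1** (volume side from p. 380's chain in cube-count form, `hchain`). [folklore] -/
theorem hw_of_stepDisplays_rounded {K₀ : ℕ} (hc : 0 ≤ cΛ) (hM : 0 ≤ M) (hℓ : ∀ K j, j ≤ K → 0 ≤ ell (gsOf D g₀ K) j)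
    (hdisp : ∀ K, K₀ ≤ K → ∀ (j : ℕ) (g : Fin j → P),
      StepDisplaysAt (runsOf D g₀ K) j (carriersOf T 𝒮 (runsOf D g₀ K) K j g (Xs K j g)) c)
    (hclass : ∀ K, K₀ ≤ K → ∀ (j : ℕ) (g : Fin j → P) (p : P),
      ∀ x ∈ (𝒮.runPartial K (j + 1) (Fin.snoc g p)).histM.newPairs (j + 1),
        (Xs K j g).dC p x = (𝒮.κ K ((𝒮.runPartial K (j + 1) (Fin.snoc g p)).histM.newAt (j + 1) x) : ℝ))
    (hchain : ∀ K, K₀ ≤ K → ∀ (j : ℕ) (g : Fin j → P) (p : P),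
      c.C' * (Xs K j g).volZΩ p + c.C380 * Real.log ((gsOf D g₀ K (j + 1)) ^ 2)⁻¹ * (Xs K j g).volZ p ≤
        uvolL cΛ M d (gsOf D g₀ K) (𝒮.R K) K (j + 1) *
          ∑ cc ∈ (𝒮.runPartial K (j + 1) (Fin.snoc g p)).histM.comp (j + 1), ((cc.2).card : ℝ))
    (hd : c.d = O.d) (hR : ∀ K h, c.R (gsOf D g₀ K h) = (𝒮.R K h : ℝ))
    (hP : ∀ K h, c.P1 (gsOf D g₀ K h) = ell (gsOf D g₀ K) h ^ p₁) :
    HwPinned T 𝒮 (sBsharp (runsOf D g₀) c) (sRrnd D O p₁ g₀ 𝒮.R) cΛ M (gsOf D g₀) K₀ :=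
  hw_of_stepDisplays_rounded_of_hvol D O p₁ g₀ T 𝒮 c Xs cΛ M hc hM hℓ hdisp hclass
    (hvol_of_chain T 𝒮 (runsOf D g₀) c Xs cΛ M (gsOf D g₀) hdisp hchain) hd hR hP

/-- **… WITH THE CLASS JUNCTION IN ITS `≤` FORM** (`hclassle`; needs print's sign `0 ≤ γ₀`), the volume side as `hvol`. [folklore] -/
theorem hw_of_stepDisplays_rounded_le {K₀ : ℕ} (hc : 0 ≤ cΛ) (hM : 0 ≤ M) (hℓ : ∀ K j, j ≤ K → 0 ≤ ell (gsOf D g₀ K) j)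
    (hγ : 0 ≤ c.γ₀)
    (hdisp : ∀ K, K₀ ≤ K → ∀ (j : ℕ) (g : Fin j → P),
      StepDisplaysAt (runsOf D g₀ K) j (carriersOf T 𝒮 (runsOf D g₀ K) K j g (Xs K j g)) c)
    (hclassle : ∀ K, K₀ ≤ K → ∀ (j : ℕ) (g : Fin j → P) (p : P),
      ∀ x ∈ (𝒮.runPartial K (j + 1) (Fin.snoc g p)).histM.newPairs (j + 1),
        (𝒮.κ K ((𝒮.runPartial K (j + 1) (Fin.snoc g p)).histM.newAt (j + 1) x) : ℝ) ≤ (Xs K j g).dC p x)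
    (hvol : ∀ K, K₀ ≤ K → ∀ (j : ℕ) (g : Fin j → P) (p : P),
      (Xs K j g).gInt p * (Xs K j g).aInt p * (Xs K j g).vfac p ≤
        ∏ cc ∈ (𝒮.runPartial K (j + 1) (Fin.snoc g p)).histM.comp (j + 1),
          ΛexpL cΛ M d (gsOf D g₀) 𝒮.R K (j + 1) ^ (cc.2).card)
    (hd : c.d = O.d) (hR : ∀ K h, c.R (gsOf D g₀ K h) = (𝒮.R K h : ℝ))
    (hP : ∀ K h, c.P1 (gsOf D g₀ K h) = ell (gsOf D g₀ K) h ^ p₁) :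
    HwPinned T 𝒮 (sBsharp (runsOf D g₀) c) (sRrnd D O p₁ g₀ 𝒮.R) cΛ M (gsOf D g₀) K₀ :=
  (hwPinned_of_stepDisplaysAt_le T 𝒮 (runsOf D g₀) c Xs cΛ M (gsOf D g₀) hc hM hℓ hγ hdisp hclassle hvol).of_le
    (fun _ _ _ => le_rfl) (fun K h => (sRrnd_eq_sRsharp D O p₁ g₀ 𝒮.R c hd hR hP K h).le) le_rfl hM hℓ hc

end Junction

end

end Summit.QuantumFields.BalabanUV.T4Continuum.B16HistoryTowerEndPrintedR
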